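import Literature.MathematicalPhysics.QuantumManyBody.JelliumBoxCutoffs
import HarnessLib

/-!
# Lieb–Solovej Lemma 4.2: changing the cutoffs in the one-box Hamiltonian

Topic `Literature/MathematicalPhysics/QuantumManyBody` (the charged Bose gas, `JelliumBoseGas.foldyLaw`).
[LiebSolovej2001, Lemma 4.2]: for `0 < r' ≤ r ≤ R ≤ R'` (`≤ ω(t)⁻¹ℓ`),
`H^n_{ℓ,r',R'} ≥ H^n_{ℓ,r,R} - ½ n R⁻¹ - const₁ n ρ r²`, by "the same arguments as before" applied
to `V_{r',R'} - V_{r,R} = (Y_{R'⁻¹} - Y_{R⁻¹}) + (Y_{r⁻¹} - Y_{r'⁻¹})`: the first bracket is a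
positive-type kernel with value `R⁻¹ - R'⁻¹ ≤ R⁻¹` at the origin ((4.3)), the second is pointwise
nonnegative with integral `4π(r² - r'²) ≤ 4πr²` ((4.4)).

We prove it in the box vocabulary of `JelliumBoxCutoffs.lean`, through the additivity of the box
potential `𝓔_K = ∑_{i<j}w_K - ρ∑ⱼ∫w_K(xⱼ,y)dy + ½ρ²∬w_K` in the kernel `K`:

* `JelliumBoseGas.integral_yukawa` — `∫ Y_a = 4π/a²`;
* `JelliumBoseGas.pairK_add`, `oneBodyK_add`, `selfEnergyK_add` — additivity in `K`;
* `JelliumBoseGas.potential_yukawaDiff_ge` — (4.3) in the box vocabulary: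
  `𝓔_{Y_a - Y_b}(X) ≥ -½(b - a)∑θ(xᵢ)²` for distinct points, `a ≤ b`;
* `JelliumBoseGas.potential_nonneg_kernel_ge` — (4.4): `𝓔_P ≥ -ρ n ∫P` for `P ≥ 0`;
* `JelliumBoseGas.cutoffMonotone_pointwise` — Lemma 4.2 for a configuration of distinct points;
* `JelliumBoseGas.boxEnergyK_le_of_pointwise` — integration of a pointwise comparison of box
  potentials against `|Φ|²`;
* `JelliumBoseGas.boxEnergyK_cutoff_mono`, `boxGroundStateEnergyK_cutoff_mono` — **Lemma 4.2**
  for the quadratic forms and for `inf Spec`.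

## References

* [LiebSolovej2001] E. H. Lieb, J. P. Solovej, Commun. Math. Phys. 217 (2001) 127–163, Lemma 4.2
  (arXiv:cond-mat/0007425, p. 10).
-/

noncomputable section

open MeasureTheory Set Filter Real
open scoped ENNReal NNReal Topology

namespace Literature.MathematicalPhysics.QuantumManyBody.JelliumBoseGas

open BoseGas Coulomb Literature.Analysis.UnboundedOperators

variable {n : ℕ} {ℓ : ℝ}

/-! ### `∫ Y_a = 4π/a²` -/

/-- **`∫_{ℝ³} e^{-a|x|}/|x| dx = 4π/a²`** (`a > 0`), through the subordination formula.
[cite: LiebLoss2001, Thm. 6.23] -/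
theorem integral_yukawa {a : ℝ} (ha : 0 < a) : ∫ x, yukawa a x = 4 * π / a ^ 2 := by
  obtain ⟨-, -, hval⟩ := integral_yukawaKernel (μ := a ^ 2) (by positivity)
  have hae : ∀ᵐ x : Space ∂volume, x ≠ 0 := compl_mem_ae_iff.2 (measure_singleton 0)
  have h : ∫ x, yukawa a x = ∫ x : Space, (4 * π) * ∫ s in Ioi (0 : ℝ), Real.exp (-(a ^ 2 * s)) * heatKernel s x := by
    refine integral_congr_ae ?_
    filter_upwards [hae] with x hx
    rw [subordinated_eq_yukawa ha hx, ← mul_assoc, mul_inv_cancel₀ (by positivity), one_mul]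
  rw [h, integral_const_mul, hval]
  ring

/-! ### Additivity of the box potential in the kernel -/

section Additivity

variable {K K₁ K₂ θ : Space → ℝ}

/-- `y ↦ θ(y) K(x - y)` is integrable for bounded measurable `θ` and `K ∈ L¹`. [folklore] -/
theorem integrable_mul_kernel_sub (hθm : Measurable θ) {M : ℝ} (hθM : ∀ y, ‖θ y‖ ≤ M)
    (hKi : Integrable K) (x : Space) : Integrable fun y : Space => θ y * K (x - y) :=
  (hKi.comp_sub_left x).bdd_mul (c := M) hθm.aestronglyMeasurable (Eventually.of_forall hθM)

/-- `x ↦ θ(x) U_K(x)` is integrable for `θ ∈ L¹`, `0 ≤ θ ≤ 1`, `K ≥ 0` integrable. [folklore] -/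
theorem integrable_mul_backgroundK (hθm : Measurable θ) (hθi : Integrable θ) (hθ0 : ∀ x, 0 ≤ θ x)
    (hθ1 : ∀ x, θ x ≤ 1) (hK : ∀ x, 0 ≤ K x) (hKm : Measurable K) (hKi : Integrable K) :
    Integrable fun x : Space => θ x * backgroundK K θ x := by
  have hb : ∀ x, ‖backgroundK K θ x‖ ≤ ∫ y, K y := fun x => by
    rw [Real.norm_eq_abs, abs_of_nonneg (backgroundK_nonneg hK hθ0 x)]
    exact backgroundK_le hK hKi hθ0 hθ1 x
  have h := hθi.bdd_mul (c := ∫ y, K y) (measurable_backgroundK hKm hθm).aestronglyMeasurable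
    (Eventually.of_forall hb)
  simpa only [mul_comm] using h

/-- Additivity of the pair term in the kernel. [folklore] -/
theorem pairK_add (K₁ K₂ θ : Space → ℝ) (X : Config n) :
    pairK (K₁ + K₂) θ X = pairK K₁ θ X + pairK K₂ θ X := by
  unfold pairK
  rw [← Finset.sum_add_distrib]
  refine Finset.sum_congr rfl fun i _ => ?_
  rw [← Finset.sum_add_distrib]
  refine Finset.sum_congr rfl fun j _ => ?_
  simp only [Pi.add_apply]
  ring

/-- Additivity of the smeared background in the kernel. [folklore] -/
theorem backgroundK_add {x : Space} (h1 : Integrable fun y : Space => θ y * K₁ (x - y))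
    (h2 : Integrable fun y : Space => θ y * K₂ (x - y)) :
    backgroundK (K₁ + K₂) θ x = backgroundK K₁ θ x + backgroundK K₂ θ x := by
  unfold backgroundK
  rw [← integral_add h1 h2]
  refine integral_congr_ae (Eventually.of_forall fun y => ?_)
  simp only [Pi.add_apply]
  ring

/-- Additivity of the one-body term in the kernel. [folklore] -/
theorem oneBodyK_add (h1 : ∀ x, Integrable fun y : Space => θ y * K₁ (x - y))
    (h2 : ∀ x, Integrable fun y : Space => θ y * K₂ (x - y)) (X : Config n) :
    oneBodyK (K₁ + K₂) θ X = oneBodyK K₁ θ X + oneBodyK K₂ θ X := by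
  unfold oneBodyK
  rw [← Finset.sum_add_distrib]
  refine Finset.sum_congr rfl fun j _ => ?_
  rw [backgroundK_add (h1 _) (h2 _)]
  ring

/-- Additivity of the background self-energy in the kernel. [folklore] -/
theorem selfEnergyK_add (h1 : ∀ x, Integrable fun y : Space => θ y * K₁ (x - y))
    (h2 : ∀ x, Integrable fun y : Space => θ y * K₂ (x - y))
    (hb1 : Integrable fun x : Space => θ x * backgroundK K₁ θ x)
    (hb2 : Integrable fun x : Space => θ x * backgroundK K₂ θ x) :
    selfEnergyK (K₁ + K₂) θ = selfEnergyK K₁ θ + selfEnergyK K₂ θ := by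
  unfold selfEnergyK
  rw [← mul_add, ← integral_add hb1 hb2]
  congr 1
  refine integral_congr_ae (Eventually.of_forall fun x => ?_)
  show θ x * backgroundK (K₁ + K₂) θ x = θ x * backgroundK K₁ θ x + θ x * backgroundK K₂ θ x
  rw [backgroundK_add (h1 x) (h2 x)]
  ring

/-- **Additivity of the box potential** `𝓔_K = ∑_{i<j}w_K - ρ∑ⱼ∫w_K + ½ρ²∬w_K` in `K`, for
`0 ≤ θ ≤ 1` measurable integrable and `K₁, K₂ ≥ 0` measurable integrable.
[cite: LiebSolovej2001, Lemma 4.2 (proof)] -/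
theorem potential_add (hθm : Measurable θ) (hθi : Integrable θ) (hθ0 : ∀ x, 0 ≤ θ x)
    (hθ1 : ∀ x, θ x ≤ 1) (hK1 : ∀ x, 0 ≤ K₁ x) (hK1m : Measurable K₁) (hK1i : Integrable K₁)
    (hK2 : ∀ x, 0 ≤ K₂ x) (hK2m : Measurable K₂) (hK2i : Integrable K₂) (ρ : ℝ) (X : Config n) :
    pairK (K₁ + K₂) θ X - ρ * oneBodyK (K₁ + K₂) θ X + ρ ^ 2 * selfEnergyK (K₁ + K₂) θ =
      (pairK K₁ θ X - ρ * oneBodyK K₁ θ X + ρ ^ 2 * selfEnergyK K₁ θ) +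
        (pairK K₂ θ X - ρ * oneBodyK K₂ θ X + ρ ^ 2 * selfEnergyK K₂ θ) := by
  have hθM : ∀ y, ‖θ y‖ ≤ 1 := fun y => by
    rw [Real.norm_eq_abs, abs_of_nonneg (hθ0 y)]; exact hθ1 y
  have h1 := integrable_mul_kernel_sub hθm hθM hK1i
  have h2 := integrable_mul_kernel_sub hθm hθM hK2i
  rw [pairK_add, oneBodyK_add h1 h2,
    selfEnergyK_add h1 h2 (integrable_mul_backgroundK hθm hθi hθ0 hθ1 hK1 hK1m hK1i)
      (integrable_mul_backgroundK hθm hθi hθ0 hθ1 hK2 hK2m hK2i)]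
  ring

end Additivity

/-! ### (4.3) and (4.4) in the box vocabulary -/

section Pieces

variable {θ : Space → ℝ}

/-- The subordinated difference kernel is `(Y_a - Y_b)/(4π)` off the origin.
[cite: LiebSolovej2001, (4.2)] -/
theorem subordinatedDiff_eq_yukawa_sub {a b : ℝ} (ha : 0 < a) (hb : 0 < b) {z : Space} (hz : z ≠ 0) :
    ∫ s in Ioi (0 : ℝ), (Real.exp (-(a ^ 2 * s)) - Real.exp (-(b ^ 2 * s))) * heatKernel s z =
      (4 * π)⁻¹ * (yukawa a - yukawa b) z := by
  have h1 := integral_Ioi_exp_neg_mul_heatKernel hz (by positivity : 0 < a ^ 2)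
  have h2 := integral_Ioi_exp_neg_mul_heatKernel hz (by positivity : 0 < b ^ 2)
  simp_rw [sub_mul]
  rw [integral_sub h1.1 h2.1, subordinated_eq_yukawa ha hz, subordinated_eq_yukawa hb hz,
    Pi.sub_apply]
  ring

/-- `Y_a - Y_b ≥ 0` for `a ≤ b`. [folklore] -/
theorem yukawa_sub_nonneg {a b : ℝ} (hab : a ≤ b) (x : Space) : 0 ≤ (yukawa a - yukawa b) x := by
  rw [Pi.sub_apply, sub_nonneg]
  unfold yukawa
  refine div_le_div_of_nonneg_right ?_ (norm_nonneg _)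
  exact Real.exp_le_exp.2 (by nlinarith [norm_nonneg x])

/-- The arithmetic of (4.3): undo the normalisation `/(4π)`. [cite: LiebSolovej2001, (4.3)] -/
theorem yukawaDiff_arith {a' P B S pW obW seW ρ E e : ℝ} (ha : 0 < a')
    (h : -E ≤ P - B + 1 / 2 * S) (hP : P = a' * pW) (hB : B = a' * (ρ * obW))
    (hS : S = a' * (ρ ^ 2 * (2 * seW))) (hE : E = a' * e) :
    -e ≤ pW - ρ * obW + ρ ^ 2 * seW := by
  subst hP hB hS hE
  have h' : a' * (-e) ≤ a' * (pW - ρ * obW + ρ ^ 2 * seW) := by nlinarith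
  exact le_of_mul_le_mul_left h' ha

/-- **(4.3) in the box vocabulary** [LiebSolovej2001, §4]: for `0 < a ≤ b`, `0 ≤ θ ≤ 1` measurable
and integrable, any `ρ`, and distinct points,
`-½(b - a)∑ᵢθ(xᵢ)² ≤ 𝓔_{Y_a - Y_b}(x₁,…,x_n)` — the kernel `θ(x)(Y_a - Y_b)(x-y)θ(y)` is of positive
type with `(Y_a - Y_b)(0⁺) = b - a` (`Coulomb.yukawaCutoff_points_ge`). [cite: LiebSolovej2001, (4.3)] -/
theorem potential_yukawaDiff_ge (hθm : Measurable θ) (hθi : Integrable θ) (hθ0 : ∀ x, 0 ≤ θ x)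
    (hθ1 : ∀ x, θ x ≤ 1) {a b : ℝ} (ha : 0 < a) (hab : a ≤ b) (ρ : ℝ) {X : Config n}
    (hX : Function.Injective X) :
    -(1 / 2 * (b - a) * ∑ i, θ (X i) ^ 2) ≤
      pairK (yukawa a - yukawa b) θ X - ρ * oneBodyK (yukawa a - yukawa b) θ X +
        ρ ^ 2 * selfEnergyK (yukawa a - yukawa b) θ := by
  have hb : 0 < b := ha.trans_le hab
  have hθM : ∀ y, ‖θ y‖ ≤ 1 := fun y => by
    rw [Real.norm_eq_abs, abs_of_nonneg (hθ0 y)]; exact hθ1 y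
  have h := yukawaCutoff_points_ge ha hab (fun i => θ (X i)) X (g := fun y => ρ * θ y)
    (hθm.const_mul ρ) (hθi.const_mul ρ)
  have hk : ∀ z : Space, z ≠ 0 → (∫ s in Ioi (0 : ℝ),
      (Real.exp (-(a ^ 2 * s)) - Real.exp (-(b ^ 2 * s))) * heatKernel s z) =
      (4 * π)⁻¹ * (yukawa a - yukawa b) z := fun z hz => subordinatedDiff_eq_yukawa_sub ha hb hz
  have hWi : Integrable (yukawa a - yukawa b) := (integrable_yukawa' ha).sub (integrable_yukawa' hb)
  have hB : ∑ i, θ (X i) * ∫ y, ρ * θ y * ∫ s in Ioi (0 : ℝ),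
      (Real.exp (-(a ^ 2 * s)) - Real.exp (-(b ^ 2 * s))) * heatKernel s (X i - y) =
      (4 * π)⁻¹ * (ρ * oneBodyK (yukawa a - yukawa b) θ X) := by
    unfold oneBodyK
    rw [Finset.mul_sum, Finset.mul_sum]
    refine Finset.sum_congr rfl fun i _ => ?_
    rw [integral_background_eq_inv_mul_backgroundK hk ρ (X i)]
    ring
  have hE : 1 / 2 * ((b - a) / (4 * π)) * ∑ i, θ (X i) ^ 2 =
      (4 * π)⁻¹ * (1 / 2 * (b - a) * ∑ i, θ (X i) ^ 2) := by
    rw [div_eq_mul_inv]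
    ring
  exact yukawaDiff_arith (by positivity : (0 : ℝ) < (4 * π)⁻¹) h
    (sum_pair_eq_inv_mul_pairK hk hX) hB (integral_prod_background_eq hk hθm hθi hθM hWi ρ) hE

/-- **(4.4) in the box vocabulary** [LiebSolovej2001, §4]: for a pointwise nonnegative integrable
kernel `P`, `0 ≤ θ ≤ 1`, `ρ ≥ 0`: `-ρ n ∫P ≤ 𝓔_P(X)` (drop the nonnegative repulsion and
self-energy; the attraction is at most `ρ∑ⱼθ(xⱼ)∫θ(y)P(xⱼ-y)dy ≤ ρ n ∫P`).
[cite: LiebSolovej2001, (4.4)] -/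
theorem potential_nonneg_kernel_ge {P : Space → ℝ} (hP : ∀ x, 0 ≤ P x) (hPi : Integrable P)
    (hθ0 : ∀ x, 0 ≤ θ x) (hθ1 : ∀ x, θ x ≤ 1) {ρ : ℝ} (hρ : 0 ≤ ρ) (X : Config n) :
    -(ρ * (n * ∫ y, P y)) ≤ pairK P θ X - ρ * oneBodyK P θ X + ρ ^ 2 * selfEnergyK P θ := by
  have h1 := pairK_nonneg hP hθ0 X
  have h2 := oneBodyK_le hP hPi hθ0 hθ1 X
  have h3 := selfEnergyK_nonneg hP hθ0 (K := P)
  nlinarith [mul_le_mul_of_nonneg_left h2 hρ, mul_nonneg (sq_nonneg ρ) h3]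

end Pieces

/-! ### Lemma 4.2 for a configuration of distinct points -/

section Pointwise

variable {θ : Space → ℝ} {r r' R R' ρ : ℝ}

/-- `V_{r',R'} = V_{r,R} + (Y_{R'⁻¹} - Y_{R⁻¹}) + (Y_{r⁻¹} - Y_{r'⁻¹})`.
[cite: LiebSolovej2001, Lemma 4.2 (proof)] -/
theorem cutoffKernel_decompose (r r' R R' : ℝ) :
    cutoffKernel r' R' = cutoffKernel r R + (yukawa R'⁻¹ - yukawa R⁻¹) + (yukawa r⁻¹ - yukawa r'⁻¹) := by
  funext x
  simp only [cutoffKernel, Pi.add_apply, Pi.sub_apply]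
  ring

/-- **[LiebSolovej2001, Lemma 4.2] for distinct points**: for `0 < r' ≤ r ≤ R ≤ R'`, `0 ≤ θ ≤ 1`
measurable and integrable, `ρ ≥ 0` and distinct `x₁,…,x_n`,
`𝓔_{V_{r,R}}(X) - ½ n R⁻¹ - 4π n ρ r² ≤ 𝓔_{V_{r',R'}}(X)`. [cite: LiebSolovej2001, Lemma 4.2] -/
theorem cutoffMonotone_pointwise (hθm : Measurable θ) (hθi : Integrable θ) (hθ0 : ∀ x, 0 ≤ θ x)
    (hθ1 : ∀ x, θ x ≤ 1) (hr' : 0 < r') (hr'r : r' ≤ r) (hrR : r ≤ R) (hRR' : R ≤ R')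
    (hρ : 0 ≤ ρ) {X : Config n} (hX : Function.Injective X) :
    pairK (cutoffKernel r R) θ X - ρ * oneBodyK (cutoffKernel r R) θ X +
        ρ ^ 2 * selfEnergyK (cutoffKernel r R) θ - (1 / 2 * n * R⁻¹ + 4 * π * n * ρ * r ^ 2) ≤
      pairK (cutoffKernel r' R') θ X - ρ * oneBodyK (cutoffKernel r' R') θ X +
        ρ ^ 2 * selfEnergyK (cutoffKernel r' R') θ := by
  have hr : 0 < r := hr'.trans_le hr'r
  have hR : 0 < R := hr.trans_le hrR
  have hR' : 0 < R' := hR.trans_le hRR'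
  have haR : R'⁻¹ ≤ R⁻¹ := (inv_le_inv₀ hR' hR).2 hRR'
  have har : r⁻¹ ≤ r'⁻¹ := (inv_le_inv₀ hr hr').2 hr'r
  -- the three kernels
  have hV0 : ∀ x, 0 ≤ cutoffKernel r R x := cutoffKernel_nonneg hr hrR
  have hVm : Measurable (cutoffKernel r R) := measurable_cutoffKernel r R
  have hVi : Integrable (cutoffKernel r R) := integrable_cutoffKernel hr hR
  have hW0 : ∀ x, 0 ≤ (yukawa R'⁻¹ - yukawa R⁻¹) x := yukawa_sub_nonneg haR
  have hWm : Measurable (yukawa R'⁻¹ - yukawa R⁻¹) := (measurable_yukawa _).sub (measurable_yukawa _)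
  have hWi : Integrable (yukawa R'⁻¹ - yukawa R⁻¹) :=
    (integrable_yukawa' (inv_pos.2 hR')).sub (integrable_yukawa' (inv_pos.2 hR))
  have hP0 : ∀ x, 0 ≤ (yukawa r⁻¹ - yukawa r'⁻¹) x := yukawa_sub_nonneg har
  have hPm : Measurable (yukawa r⁻¹ - yukawa r'⁻¹) := (measurable_yukawa _).sub (measurable_yukawa _)
  have hPi : Integrable (yukawa r⁻¹ - yukawa r'⁻¹) :=
    (integrable_yukawa' (inv_pos.2 hr)).sub (integrable_yukawa' (inv_pos.2 hr'))
  have hVW0 : ∀ x, 0 ≤ (cutoffKernel r R + (yukawa R'⁻¹ - yukawa R⁻¹)) x := fun x =>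
    add_nonneg (hV0 x) (hW0 x)
  -- additivity
  rw [cutoffKernel_decompose r r' R R',
    potential_add hθm hθi hθ0 hθ1 hVW0 (hVm.add hWm) (hVi.add hWi) hP0 hPm hPi ρ X,
    potential_add hθm hθi hθ0 hθ1 hV0 hVm hVi hW0 hWm hWi ρ X]
  -- the two error pieces
  have hWge := potential_yukawaDiff_ge hθm hθi hθ0 hθ1 (inv_pos.2 hR') haR ρ hX
  have hPge := potential_nonneg_kernel_ge hP0 hPi hθ0 hθ1 hρ X (n := n)
  have hs : ∑ i, θ (X i) ^ 2 ≤ n := by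
    calc ∑ i, θ (X i) ^ 2 ≤ ∑ _i : Fin n, (1 : ℝ) :=
          Finset.sum_le_sum fun i _ => by nlinarith [hθ0 (X i), hθ1 (X i)]
      _ = n := by simp
  have hE1 : 1 / 2 * (R⁻¹ - R'⁻¹) * ∑ i, θ (X i) ^ 2 ≤ 1 / 2 * n * R⁻¹ := by
    have h1 : R⁻¹ - R'⁻¹ ≤ R⁻¹ := sub_le_self _ (inv_nonneg.2 hR'.le)
    have h2 : 0 ≤ ∑ i, θ (X i) ^ 2 := Finset.sum_nonneg fun i _ => sq_nonneg _
    nlinarith [mul_le_mul h1 hs h2 (inv_nonneg.2 hR.le)]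
  have hE2 : ρ * (n * ∫ y, (yukawa r⁻¹ - yukawa r'⁻¹) y) ≤ 4 * π * n * ρ * r ^ 2 := by
    have hI : ∫ y, (yukawa r⁻¹ - yukawa r'⁻¹) y ≤ 4 * π * r ^ 2 := by
      have e : ∫ y, (yukawa r⁻¹ - yukawa r'⁻¹) y = 4 * π * r ^ 2 - 4 * π * r' ^ 2 := by
        change ∫ y, (yukawa r⁻¹ y - yukawa r'⁻¹ y) = _
        rw [integral_sub (integrable_yukawa' (inv_pos.2 hr)) (integrable_yukawa' (inv_pos.2 hr')),
          integral_yukawa (inv_pos.2 hr), integral_yukawa (inv_pos.2 hr'), inv_pow, inv_pow,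
          div_inv_eq_mul, div_inv_eq_mul]
      rw [e]
      nlinarith [Real.pi_pos, sq_nonneg r']
    have := mul_le_mul_of_nonneg_left (mul_le_mul_of_nonneg_left hI (Nat.cast_nonneg n)) hρ
    linarith
  linarith

end Pointwise

/-! ### Integration against `|Φ|²` and Lemma 4.2 -/

section BoxLemma

variable {θ : Space → ℝ}

/-- **Integrating a comparison of box potentials** against `|Φ|²`: if `0 ≤ K₁, K₂ ≤ |x|⁻¹` are
measurable and integrable, `0 ≤ θ ≤ 1` measurable, `g, ρ ≥ 0`, `err ≥ 0`, and
`𝓔_{K₂}(X) - err ≤ 𝓔_{K₁}(X)` for all configurations of distinct points, then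
`boxEnergyK κ g ρ K₂ θ Φ - g·err ≤ boxEnergyK κ g ρ K₁ θ Φ` for every Neumann trial state.
[cite: LiebSolovej2001, Lemma 4.1 and 4.2 (proof)] -/
theorem boxEnergyK_le_of_pointwise {κ g ρ : ℝ} (hg : 0 ≤ g) (hρ : 0 ≤ ρ) (hθm : Measurable θ)
    (hθ0 : ∀ x, 0 ≤ θ x) (hθ1 : ∀ x, θ x ≤ 1) {K₁ K₂ : Space → ℝ}
    (h10 : ∀ x, 0 ≤ K₁ x) (h11 : ∀ x, K₁ x ≤ ‖x‖⁻¹) (h1m : Measurable K₁) (h1i : Integrable K₁)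
    (h20 : ∀ x, 0 ≤ K₂ x) (h21 : ∀ x, K₂ x ≤ ‖x‖⁻¹) (h2m : Measurable K₂) (h2i : Integrable K₂)
    {err : ℝ} (herr0 : 0 ≤ err)
    (hpt : ∀ X : Config n, Function.Injective X →
      pairK K₂ θ X - ρ * oneBodyK K₂ θ X + ρ ^ 2 * selfEnergyK K₂ θ - err ≤
        pairK K₁ θ X - ρ * oneBodyK K₁ θ X + ρ ^ 2 * selfEnergyK K₁ θ)
    (Φ : NeumannTrialState n ℓ) :
    boxEnergyK κ g ρ K₂ θ Φ - g * err ≤ boxEnergyK κ g ρ K₁ θ Φ := by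
  -- the pointwise inequality, rearranged with nonnegative terms, a.e. on the box
  have hae : ∀ᵐ X : Config n ∂(volume.restrict (boxN n ℓ)),
      (ENNReal.ofReal (pairK K₂ θ X) + ENNReal.ofReal ρ * ENNReal.ofReal (oneBodyK K₁ θ X) +
          ENNReal.ofReal (ρ ^ 2 * selfEnergyK K₂ θ)) * (‖Φ.ψ X‖₊ : ℝ≥0∞) ^ 2 ≤
        (ENNReal.ofReal (pairK K₁ θ X) + ENNReal.ofReal ρ * ENNReal.ofReal (oneBodyK K₂ θ X) +
          ENNReal.ofReal (ρ ^ 2 * selfEnergyK K₁ θ + err)) * (‖Φ.ψ X‖₊ : ℝ≥0∞) ^ 2 := by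
    filter_upwards [ae_restrict_of_ae (ae_injective n)] with X hX
    refine mul_le_mul' ?_ le_rfl
    have h := hpt X hX
    have hreal : pairK K₂ θ X + ρ * oneBodyK K₁ θ X + ρ ^ 2 * selfEnergyK K₂ θ ≤
        pairK K₁ θ X + ρ * oneBodyK K₂ θ X + (ρ ^ 2 * selfEnergyK K₁ θ + err) := by linarith
    have e1 := pairK_nonneg h20 hθ0 X
    have e2 := mul_nonneg hρ (oneBodyK_nonneg h10 hθ0 X)
    have e3 := mul_nonneg (sq_nonneg ρ) (selfEnergyK_nonneg h20 hθ0)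
    have e4 := pairK_nonneg h10 hθ0 X
    have e5 := mul_nonneg hρ (oneBodyK_nonneg h20 hθ0 X)
    have e6 := add_nonneg (mul_nonneg (sq_nonneg ρ) (selfEnergyK_nonneg h10 hθ0)) herr0
    rw [← ENNReal.ofReal_mul hρ, ← ENNReal.ofReal_mul hρ, ← ENNReal.ofReal_add e1 e2,
      ← ENNReal.ofReal_add (add_nonneg e1 e2) e3, ← ENNReal.ofReal_add e4 e5,
      ← ENNReal.ofReal_add (add_nonneg e4 e5) e6]
    exact ENNReal.ofReal_le_ofReal hreal
  -- integrate over the box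
  have hWm : Measurable fun X : Config n => (‖Φ.ψ X‖₊ : ℝ≥0∞) ^ 2 := measurable_normSq_trial Φ
  have hmP2 : Measurable fun X : Config n => ENNReal.ofReal (pairK K₂ θ X) * (‖Φ.ψ X‖₊ : ℝ≥0∞) ^ 2 :=
    (measurable_pairK h2m hθm).ennreal_ofReal.mul hWm
  have hmP1 : Measurable fun X : Config n => ENNReal.ofReal (pairK K₁ θ X) * (‖Φ.ψ X‖₊ : ℝ≥0∞) ^ 2 :=
    (measurable_pairK h1m hθm).ennreal_ofReal.mul hWm
  have hmB1 : Measurable fun X : Config n =>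
      ENNReal.ofReal ρ * ENNReal.ofReal (oneBodyK K₁ θ X) * (‖Φ.ψ X‖₊ : ℝ≥0∞) ^ 2 :=
    (((measurable_oneBodyK h1m hθm).ennreal_ofReal).const_mul _).mul hWm
  have hmB2 : Measurable fun X : Config n =>
      ENNReal.ofReal ρ * ENNReal.ofReal (oneBodyK K₂ θ X) * (‖Φ.ψ X‖₊ : ℝ≥0∞) ^ 2 :=
    (((measurable_oneBodyK h2m hθm).ennreal_ofReal).const_mul _).mul hWm
  have hmL : Measurable fun X : Config n => ENNReal.ofReal (pairK K₂ θ X) * (‖Φ.ψ X‖₊ : ℝ≥0∞) ^ 2 +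
      ENNReal.ofReal ρ * ENNReal.ofReal (oneBodyK K₁ θ X) * (‖Φ.ψ X‖₊ : ℝ≥0∞) ^ 2 := hmP2.add hmB1
  have hmR : Measurable fun X : Config n => ENNReal.ofReal (pairK K₁ θ X) * (‖Φ.ψ X‖₊ : ℝ≥0∞) ^ 2 +
      ENNReal.ofReal ρ * ENNReal.ofReal (oneBodyK K₂ θ X) * (‖Φ.ψ X‖₊ : ℝ≥0∞) ^ 2 := hmP1.add hmB2
  have hint := lintegral_mono_ae hae
  simp only [add_mul] at hint
  rw [lintegral_add_left hmL, lintegral_add_left hmP2,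
    lintegral_add_left hmR, lintegral_add_left hmP1,
    lintegral_const_mul' _ _ ENNReal.ofReal_ne_top, lintegral_const_mul' _ _ ENNReal.ofReal_ne_top,
    Φ.norm_eq, mul_one, mul_one] at hint
  simp_rw [mul_assoc (ENNReal.ofReal ρ)] at hint
  rw [lintegral_const_mul' _ _ ENNReal.ofReal_ne_top, lintegral_const_mul' _ _ ENNReal.ofReal_ne_top] at hint
  -- finiteness and passage to reals
  have hP2t : pairExpectationK K₂ θ Φ ≠ ⊤ := pairExpectationK_ne_top h20 h21 hθ0 hθ1 Φ
  have hP1t : pairExpectationK K₁ θ Φ ≠ ⊤ := pairExpectationK_ne_top h10 h11 hθ0 hθ1 Φ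
  have hB2t : oneBodyExpectationK K₂ θ Φ ≠ ⊤ := oneBodyExpectationK_ne_top h20 h2i hθ0 hθ1 Φ
  have hB1t : oneBodyExpectationK K₁ θ Φ ≠ ⊤ := oneBodyExpectationK_ne_top h10 h1i hθ0 hθ1 Φ
  change pairExpectationK K₂ θ Φ + ENNReal.ofReal ρ * oneBodyExpectationK K₁ θ Φ +
      ENNReal.ofReal (ρ ^ 2 * selfEnergyK K₂ θ) ≤
    pairExpectationK K₁ θ Φ + ENNReal.ofReal ρ * oneBodyExpectationK K₂ θ Φ +
      ENNReal.ofReal (ρ ^ 2 * selfEnergyK K₁ θ + err) at hint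
  have hs2 := mul_nonneg (sq_nonneg ρ) (selfEnergyK_nonneg h20 hθ0)
  have hs1 := mul_nonneg (sq_nonneg ρ) (selfEnergyK_nonneg h10 hθ0)
  have hreal : (pairExpectationK K₂ θ Φ).toReal + ρ * (oneBodyExpectationK K₁ θ Φ).toReal +
        ρ ^ 2 * selfEnergyK K₂ θ ≤
      (pairExpectationK K₁ θ Φ).toReal + ρ * (oneBodyExpectationK K₂ θ Φ).toReal +
        (ρ ^ 2 * selfEnergyK K₁ θ + err) := by
    have hl : pairExpectationK K₂ θ Φ + ENNReal.ofReal ρ * oneBodyExpectationK K₁ θ Φ +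
        ENNReal.ofReal (ρ ^ 2 * selfEnergyK K₂ θ) ≠ ⊤ :=
      ENNReal.add_ne_top.2 ⟨ENNReal.add_ne_top.2 ⟨hP2t, ENNReal.mul_ne_top ENNReal.ofReal_ne_top hB1t⟩,
        ENNReal.ofReal_ne_top⟩
    have hr' : pairExpectationK K₁ θ Φ + ENNReal.ofReal ρ * oneBodyExpectationK K₂ θ Φ +
        ENNReal.ofReal (ρ ^ 2 * selfEnergyK K₁ θ + err) ≠ ⊤ :=
      ENNReal.add_ne_top.2 ⟨ENNReal.add_ne_top.2 ⟨hP1t, ENNReal.mul_ne_top ENNReal.ofReal_ne_top hB2t⟩,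
        ENNReal.ofReal_ne_top⟩
    have h := (ENNReal.toReal_le_toReal hl hr').2 hint
    rw [ENNReal.toReal_add (ENNReal.add_ne_top.2 ⟨hP2t, ENNReal.mul_ne_top ENNReal.ofReal_ne_top hB1t⟩)
        ENNReal.ofReal_ne_top,
      ENNReal.toReal_add hP2t (ENNReal.mul_ne_top ENNReal.ofReal_ne_top hB1t),
      ENNReal.toReal_add (ENNReal.add_ne_top.2 ⟨hP1t, ENNReal.mul_ne_top ENNReal.ofReal_ne_top hB2t⟩)
        ENNReal.ofReal_ne_top,
      ENNReal.toReal_add hP1t (ENNReal.mul_ne_top ENNReal.ofReal_ne_top hB2t),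
      ENNReal.toReal_mul, ENNReal.toReal_mul, ENNReal.toReal_ofReal hρ,
      ENNReal.toReal_ofReal hs2, ENNReal.toReal_ofReal (add_nonneg hs1 herr0)] at h
    exact h
  unfold boxEnergyK
  exact boxCutoff_arith hg hreal

/-- **[LiebSolovej2001, Lemma 4.2] for the quadratic forms**: for `0 < r' ≤ r ≤ R ≤ R'`,
`0 ≤ θ ≤ 1` measurable and integrable, `g, ρ ≥ 0`, and every Neumann trial state `Φ`,
`⟨Φ, H^n_{ℓ,r,R}Φ⟩ - g n(½R⁻¹ + 4πρr²) ≤ ⟨Φ, H^n_{ℓ,r',R'}Φ⟩`. [cite: LiebSolovej2001, Lemma 4.2] -/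
theorem boxEnergyK_cutoff_mono {κ g ρ : ℝ} (hg : 0 ≤ g) (hρ : 0 ≤ ρ) (hθm : Measurable θ)
    (hθi : Integrable θ) (hθ0 : ∀ x, 0 ≤ θ x) (hθ1 : ∀ x, θ x ≤ 1) {r r' R R' : ℝ} (hr' : 0 < r')
    (hr'r : r' ≤ r) (hrR : r ≤ R) (hRR' : R ≤ R') (Φ : NeumannTrialState n ℓ) :
    boxEnergyK κ g ρ (cutoffKernel r R) θ Φ - g * (n * (1 / 2 * R⁻¹ + 4 * π * ρ * r ^ 2)) ≤
      boxEnergyK κ g ρ (cutoffKernel r' R') θ Φ := by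
  have hr : 0 < r := hr'.trans_le hr'r
  have hR : 0 < R := hr.trans_le hrR
  have hR' : 0 < R' := hR.trans_le hRR'
  refine boxEnergyK_le_of_pointwise hg hρ hθm hθ0 hθ1
    (cutoffKernel_nonneg hr' (hr'r.trans (hrR.trans hRR'))) (cutoffKernel_le_inv_norm hR')
    (measurable_cutoffKernel r' R') (integrable_cutoffKernel hr' hR')
    (cutoffKernel_nonneg hr hrR) (cutoffKernel_le_inv_norm hR) (measurable_cutoffKernel r R)
    (integrable_cutoffKernel hr hR) (by positivity) (fun X hX => ?_) Φ
  have h := cutoffMonotone_pointwise hθm hθi hθ0 hθ1 hr' hr'r hrR hRR' hρ hX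
  have e : (1 / 2 * n * R⁻¹ + 4 * π * n * ρ * r ^ 2 : ℝ) = n * (1 / 2 * R⁻¹ + 4 * π * ρ * r ^ 2) := by
    ring
  linarith

/-- **[LiebSolovej2001, Lemma 4.2]**: with the same notation, for `0 < r' ≤ r ≤ R ≤ R'`, `ℓ > 0`,
`κ, g, ρ ≥ 0`,
`inf Spec H^n_{ℓ,r,R} - g n(½R⁻¹ + 4πρr²) ≤ inf Spec H^n_{ℓ,r',R'}`
(`H^n_{ℓ,r',R'} ≥ H^n_{ℓ,r,R} - ½nR⁻¹ - const₁ nρr²`, `const₁ = 4π`, coupling `g`).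
[cite: LiebSolovej2001, Lemma 4.2] -/
theorem boxGroundStateEnergyK_cutoff_mono {κ g ρ : ℝ} (hκ : 0 ≤ κ) (hg : 0 ≤ g) (hρ : 0 ≤ ρ)
    (hθm : Measurable θ) (hθi : Integrable θ) (hθ0 : ∀ x, 0 ≤ θ x) (hθ1 : ∀ x, θ x ≤ 1)
    {r r' R R' : ℝ} (hr' : 0 < r') (hr'r : r' ≤ r) (hrR : r ≤ R) (hRR' : R ≤ R') (hℓ : 0 < ℓ) :
    boxGroundStateEnergyK κ g ρ (cutoffKernel r R) θ n ℓ - g * (n * (1 / 2 * R⁻¹ + 4 * π * ρ * r ^ 2)) ≤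
      boxGroundStateEnergyK κ g ρ (cutoffKernel r' R') θ n ℓ := by
  have hr : 0 < r := hr'.trans_le hr'r
  have hR : 0 < R := hr.trans_le hrR
  refine le_boxGroundStateEnergyK hℓ fun Φ hΦ => ?_
  calc boxGroundStateEnergyK κ g ρ (cutoffKernel r R) θ n ℓ - g * (n * (1 / 2 * R⁻¹ + 4 * π * ρ * r ^ 2))
      ≤ boxEnergyK κ g ρ (cutoffKernel r R) θ Φ - g * (n * (1 / 2 * R⁻¹ + 4 * π * ρ * r ^ 2)) :=
        sub_le_sub_right (boxGroundStateEnergyK_le hκ hg hρ (cutoffKernel_nonneg hr hrR)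
          (integrable_cutoffKernel hr hR) hθ0 hθ1 Φ hΦ) _
    _ ≤ boxEnergyK κ g ρ (cutoffKernel r' R') θ Φ :=
        boxEnergyK_cutoff_mono hg hρ hθm hθi hθ0 hθ1 hr' hr'r hrR hRR' Φ

end BoxLemma

end Literature.MathematicalPhysics.QuantumManyBody.JelliumBoseGas
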